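import Literature.Analysis.FluidPDE.AncientMildRepresentative
import Literature.Analysis.FluidPDE.KNSSThm53OfWindow
import Literature.Analysis.FluidPDE.SereginSverakBlowupSelection
import Literature.Analysis.FunctionSpaces.TestPairingLimits
import HarnessLib

/-!
# Window representatives of bounded ancient mild solutions with spatial decay (tools for item REG)

Support file for `Theorems/RootDecompFactorLadderRepresentative.lean` (item
`TypeIRdssRepresentative`
of routes `RootDecompFactorLadder` / `RootDecompThresholdSaddle`).  For a bounded ancient mild
solution `v` of Navier–Stokes (`ν = 1`, duality-form class `IsBoundedAncientMildSolution`) with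
measurable slices and the decay `‖x‖ ‖v(t,x)‖ ≤ C`:

* `continuousOn_pairing` — **weak-* continuity**: `t ↦ ∫⟪v(t), θ⟫` is continuous on `(−∞, 0)` for
  EVERY test field `θ` (the decay pins the spatial constants;
  `continuousOn_integral_inner_of_cylRadius_decay`);
* `exists_boundedWeak` — a jointly measurable, bounded modification of `v` which is a bounded weak
  solution on `ℝ³ × (−∞, 0)` in the sense of KNSS 2009, §4;
* `exists_window_rep` — **the window representative**: for every `T > 0` a field `V`, jointly
  continuous on `(−T, 0) × ℝ³`, with `V(t) = v(t)` a.e. for EVERY `t ∈ (−T, 0)`: KNSS §4 regularity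
  (`KNSS2009_regularity_boundedWeak_window_holds`, proved in the tree) gives `v = U + b(t)` a.e.
  with
  `U` smooth and time-Lipschitz; the parasitic constant is PINNED by weak-* continuity
  (`e(t) := Σᵢ (∫⟪v(t) − U(t), g bᵢ⟫) bᵢ`, `g` a unit-mass bump, is continuous and `= b(t)` a.e.),
  and for every `t` the pairings `∫⟪v(t) − V(t), θ⟫` are continuous in `t` and vanish a.e., hence
  vanish (du Bois-Reymond, tree `FunctionSpaces.ae_eq_zero_of_forall_integral_inner_test_eq_zero`).

Also: `isAncientMildSolution_congr_ae` (slice-wise a.e. modification preserves the ancient mild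
class) and `continuous_slice`.

References: Koch–Nadirashvili–Seregin–Šverák, Acta Math. 203 (2009) = arXiv:0709.3599, §4 and §1
p. 3 (the drift `b(t)`) [KochNadirashviliSereginSverak2009].
-/

noncomputable section

set_option linter.dupNamespace false

open MeasureTheory Set Function Filter Topology TopologicalSpace InnerProductSpace
open scoped RealInnerProductSpace NNReal ENNReal ContDiff
open Literature.Analysis Literature.Analysis.FluidPDE

namespace Summit.NavierStokesRegularity.NavierStokesRegularity.Theorems.RootDecompFactorLadderRepresentativeWindow

/-- Local notation for physical space `ℝ³ = EuclideanSpace ℝ (Fin 3)`. -/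
local notation "ℝ³" => EuclideanSpace ℝ (Fin 3)

/-! ### §0 Tools -/

/-- **Slice-wise a.e. modification preserves the ancient-mild class** (every clause of the class is
an integral over a slice `t < 0`). -/
theorem isAncientMildSolution_congr_ae {E : Type*} [NormedAddCommGroup E] [InnerProductSpace ℝ E]
    [FiniteDimensional ℝ E] [MeasurableSpace E] [BorelSpace E] {ν : ℝ} {u w : ℝ → E → E}
    (hu : IsAncientMildSolution ν u) (hwu : ∀ t < 0, w t =ᵐ[volume] u t) :
    IsAncientMildSolution ν w := by
  refine ⟨fun t ht => (hu.1 t ht).congr_ae (hwu t ht).symm, fun s t hst ht φ hφ hdiv => ?_⟩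
  have hs : s < 0 := hst.trans ht
  have key := hu.2 s t hst ht φ hφ hdiv
  have e1 : ∫ x, ⟪w t x, φ x⟫ = ∫ x, ⟪u t x, φ x⟫ := by
    refine integral_congr_ae ?_
    filter_upwards [hwu t ht] with x hx
    rw [hx]
  have e2 : ∫ x, ⟪w s x, heatTest ν φ (t - s) x⟫ = ∫ x, ⟪u s x, heatTest ν φ (t - s) x⟫ := by
    refine integral_congr_ae ?_
    filter_upwards [hwu s hs] with x hx
    rw [hx]
  have e3 : (∫ τ in s..t, ∫ x, ⟪w τ x, convect (w τ) (heatTest ν φ (t - τ)) x⟫) =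
      ∫ τ in s..t, ∫ x, ⟪u τ x, convect (u τ) (heatTest ν φ (t - τ)) x⟫ := by
    refine intervalIntegral.integral_congr fun τ hτ => ?_
    rw [uIcc_of_le hst.le] at hτ
    have hτ0 : τ < 0 := hτ.2.trans_lt ht
    refine integral_congr_ae ?_
    filter_upwards [hwu τ hτ0] with x hx
    simp only [convect_apply, hx]
  rw [e1, e2, e3]
  exact key

/-- The slice of a jointly continuous family is continuous. -/
theorem continuous_slice {W : ℝ → ℝ³ → ℝ³} {S : Set ℝ} (hW : ContinuousOn (uncurry W) (S ×ˢ univ))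
    {t : ℝ} (ht : t ∈ S) : Continuous (W t) :=
  hW.comp_continuous (continuous_const.prodMk continuous_id) fun _ => mem_prod.2 ⟨ht, mem_univ _⟩

/-! ### §1 Bounded ancient mild solutions with the decay `‖x‖ ‖v‖ ≤ C` -/

section Bounded

variable {v : ℝ → ℝ³ → ℝ³} {C : ℝ}

/-- **Weak-* continuity**: the decay pins the spatial constants, so every pairing
`t ↦ ∫⟪v(t), θ⟫`, `θ` ANY test field, is continuous on `(−∞, 0)`. -/
theorem continuousOn_pairing (hv : IsBoundedAncientMildSolution 1 v)
    (hmeas : ∀ t < 0, AEStronglyMeasurable (v t) volume) (hC : ∀ t < 0, ∀ x, ‖x‖ * ‖v t x‖ ≤ C)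
    {θ : ℝ³ → ℝ³} (hθ : FunctionSpaces.IsTestFunctionOn (⊤ : Opens ℝ³) θ) :
    ContinuousOn (fun t => ∫ x, ⟪v t x, θ x⟫) (Iio 0) := by
  obtain ⟨M, hM'⟩ := hv.2
  have hM : ∀ t < 0, ∀ x, ‖v t x‖ ≤ M := fun t ht x => hM' t ht x
  exact continuousOn_integral_inner_of_cylRadius_decay hM hmeas hv.1.1
    (fun φ hφ hdiv => hv.continuousOn_integral_inner one_pos hmeas hφ hdiv)
    (fun t ht x => (mul_le_mul_of_nonneg_right (SereginSverak2009.cylRadius_le_norm' x)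
      (norm_nonneg _)).trans (hC t ht x)) hθ

/-- **A bounded weak solution (KNSS 2009, §4) in the slice class of `v`.** -/
theorem exists_boundedWeak (hv : IsBoundedAncientMildSolution 1 v)
    (hmeas : ∀ t < 0, AEStronglyMeasurable (v t) volume) (hC : ∀ t < 0, ∀ x, ‖x‖ * ‖v t x‖ ≤ C) :
    ∃ (w : ℝ → ℝ³ → ℝ³) (M' : ℝ), IsBoundedWeakNSSolutionOn (Iio 0) isOpen_Iio 1 w ∧
      (∀ t < 0, w t =ᵐ[volume] v t) ∧ ∀ t x, ‖w t x‖ ≤ M' := by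
  obtain ⟨M, hM'⟩ := hv.2
  have hM : ∀ t < 0, ∀ x, ‖v t x‖ ≤ M := fun t ht x => hM' t ht x
  have hws : ∀ θ : ℝ³ → ℝ³, FunctionSpaces.IsTestFunctionOn (⊤ : Opens ℝ³) θ →
      ContinuousOn (fun t => ∫ x, ⟪v t x, θ x⟫) (Iio 0) := fun θ hθ =>
    continuousOn_pairing hv hmeas hC hθ
  obtain ⟨w₀, hw₀, hw₀v⟩ := exists_stronglyMeasurable_modification hM hmeas hws
  obtain ⟨w, hw, hwv, hwM⟩ := exists_bounded_modification
    (μ := (volume : Measure (ℝ × ℝ³)).restrict (Iio 0 ×ˢ univ)) hM hw₀.aestronglyMeasurable hw₀v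
  have hwcl : IsBoundedAncientMildSolution 1 w :=
    hv.congr_ae_slice hwv ⟨max M 0, fun t _ x => hwM t x⟩
  have hwmeas : ∀ t < 0, AEStronglyMeasurable (w t) volume := fun t ht =>
    (hmeas t ht).congr (hwv t ht).symm
  exact ⟨w, max M 0, hwcl.isBoundedWeakNSSolutionOn one_pos hw hwmeas, hwv, hwM⟩

/-- **The window representative.** For every `T > 0`, `v` has a representative jointly continuous
on `(−T, 0) × ℝ³`, equal to `v(t)` a.e. for EVERY `t ∈ (−T, 0)` (KNSS §4 regularity of the bounded
weak solution of `exists_boundedWeak` on `(−T−1, 0)`, the constant pinned by weak-* continuity). -/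
theorem exists_window_rep (hv : IsBoundedAncientMildSolution 1 v)
    (hmeas : ∀ t < 0, AEStronglyMeasurable (v t) volume) (hC : ∀ t < 0, ∀ x, ‖x‖ * ‖v t x‖ ≤ C)
    (T : ℝ) (hT : 0 < T) :
    ∃ V : ℝ → ℝ³ → ℝ³, ContinuousOn (uncurry V) (Ioo (-T) 0 ×ˢ univ) ∧
      ∀ t ∈ Ioo (-T) 0, V t =ᵐ[volume] v t := by
  obtain ⟨M, hM'⟩ := hv.2
  have hM : ∀ t < 0, ∀ x, ‖v t x‖ ≤ M := fun t ht x => hM' t ht x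
  have hws : ∀ θ : ℝ³ → ℝ³, FunctionSpaces.IsTestFunctionOn (⊤ : Opens ℝ³) θ →
      ContinuousOn (fun t => ∫ x, ⟪v t x, θ x⟫) (Iio 0) := fun θ hθ =>
    continuousOn_pairing hv hmeas hC hθ
  obtain ⟨w, M', hweak, hwv, hwM⟩ := exists_boundedWeak hv hmeas hC
  -- KNSS 2009, §4 on the window `(-T-1, 0)`, inner margin `1`
  have hwin : IsBoundedWeakNSSolutionOn (Ioo (-T - 1) 0) isOpen_Ioo 1 w :=
    hweak.mono isOpen_Ioo fun t ht => ht.2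
  obtain ⟨Cst, L, N, hshift⟩ := KNSS2009_regularity_boundedWeak_window.shift
    KNSS2009_regularity_boundedWeak_window_holds M' (T + 1) (by linarith)
  obtain ⟨U, b, -, -, -, hae, hsm, -, hbd, hlip, -⟩ :=
    hshift (-T - 1) 0 (by ring) hwin fun t _ x => hwM t x
  have hJ' : ∀ t ∈ Ioo (-T) 0, t ∈ Ioo (-T - 1 + 1) 0 := fun t ht => ⟨by linarith [ht.1], ht.2⟩
  have hUc : ∀ t ∈ Ioo (-T) 0, Continuous (U t) := fun t ht =>
    (hsm t ⟨by linarith [ht.1], ht.2⟩).continuous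
  have hU0 : ∀ s ∈ Ioo (-T) 0, ∀ t ∈ Ioo (-T) 0, ∀ x, ‖U t x - U s x‖ ≤ L 0 1 * |t - s| :=
    fun s hs t ht x => by
      rw [norm_sub_eq_norm_iteratedFDeriv_zero_sub]
      exact hlip 1 one_pos 0 s (hJ' s hs) t (hJ' t ht) x
  have hUbd : ∀ t ∈ Ioo (-T) 0, ∀ x, ‖U t x‖ ≤ Cst 0 1 := fun t ht x => by
    have h := hbd 1 one_pos 0 t (hJ' t ht) x
    rwa [norm_iteratedFDeriv_zero] at h
  -- integrability of the pairings
  have hθint : ∀ {θ : ℝ³ → ℝ³}, FunctionSpaces.IsTestFunctionOn (⊤ : Opens ℝ³) θ →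
      Integrable θ volume := fun hθ =>
    hθ.contDiff.continuous.integrable_of_hasCompactSupport hθ.hasCompactSupport
  have hiU : ∀ {θ : ℝ³ → ℝ³}, FunctionSpaces.IsTestFunctionOn (⊤ : Opens ℝ³) θ →
      ∀ t ∈ Ioo (-T) 0, Integrable (fun x => ⟪U t x, θ x⟫) volume := fun hθ t ht =>
    integrable_inner_of_aestronglyMeasurable_of_norm_le (hUc t ht).aestronglyMeasurable
      (hUbd t ht) (hθint hθ)
  have hiv : ∀ {θ : ℝ³ → ℝ³}, FunctionSpaces.IsTestFunctionOn (⊤ : Opens ℝ³) θ →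
      ∀ t < 0, Integrable (fun x => ⟪v t x, θ x⟫) volume := fun hθ t ht =>
    integrable_inner_of_aestronglyMeasurable_of_norm_le (hmeas t ht) (hM t ht) (hθint hθ)
  -- the pairings of `U` are Lipschitz in time
  have hpairU : ∀ θ : ℝ³ → ℝ³, FunctionSpaces.IsTestFunctionOn (⊤ : Opens ℝ³) θ →
      ContinuousOn (fun t => ∫ x, ⟪U t x, θ x⟫) (Ioo (-T) 0) := fun θ hθ => by
    refine continuousOn_of_norm_sub_le_mul (L := L 0 1 * ∫ x, ‖θ x‖) fun s hs t ht => ?_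
    rw [← integral_sub (hiU hθ t ht) (hiU hθ s hs)]
    calc ‖∫ x, (⟪U t x, θ x⟫ - ⟪U s x, θ x⟫)‖
        ≤ ∫ x, ‖⟪U t x, θ x⟫ - ⟪U s x, θ x⟫‖ := norm_integral_le_integral_norm _
      _ ≤ ∫ x, L 0 1 * |t - s| * ‖θ x‖ := by
          refine integral_mono_of_nonneg (Eventually.of_forall fun _ => norm_nonneg _)
            ((hθint hθ).norm.const_mul _) (Eventually.of_forall fun x => ?_)
          show ‖⟪U t x, θ x⟫ - ⟪U s x, θ x⟫‖ ≤ L 0 1 * |t - s| * ‖θ x‖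
          rw [← inner_sub_left]
          calc ‖⟪U t x - U s x, θ x⟫‖ ≤ ‖U t x - U s x‖ * ‖θ x‖ := norm_inner_le_norm _ _
            _ ≤ L 0 1 * |t - s| * ‖θ x‖ :=
                mul_le_mul_of_nonneg_right (hU0 s hs t ht x) (norm_nonneg _)
      _ = L 0 1 * (∫ x, ‖θ x‖) * |t - s| := by
          rw [integral_const_mul]
          ring
  -- unit-mass bump and frame; the pinned constant `e`
  set ρ : ContDiffBump (0 : ℝ³) := ⟨1, 2, one_pos, one_lt_two⟩ with hρ_def
  set g : ℝ³ → ℝ := ρ.normed volume with hg_def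
  have hg : FunctionSpaces.IsTestFunctionOn (⊤ : Opens ℝ³) g :=
    FunctionSpaces.isTestFunctionOn_normed ρ
  have hg1 : ∫ y, g y = 1 := ρ.integral_normed
  set bs := stdOrthonormalBasis ℝ ℝ³ with hbs_def
  have hθi : ∀ i, FunctionSpaces.IsTestFunctionOn (⊤ : Opens ℝ³) (fun y => g y • bs i) := fun i =>
    ⟨hg.contDiff.smul contDiff_const, hg.hasCompactSupport.smul_right, by simp⟩
  set e : ℝ → ℝ³ := fun t => ∑ i, (∫ y, ⟪v t y - U t y, g y • bs i⟫) • bs i with he_def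
  have hecomp : ∀ i, ContinuousOn (fun t => ∫ y, ⟪v t y - U t y, g y • bs i⟫) (Ioo (-T) 0) := by
    intro i
    have h1 := (hws _ (hθi i)).mono (Ioo_subset_Iio_self (a := -T) (b := (0 : ℝ)))
    have h2 := hpairU _ (hθi i)
    refine (h1.sub h2).congr fun t ht => ?_
    show ∫ y, ⟪v t y - U t y, g y • bs i⟫ = (∫ y, ⟪v t y, g y • bs i⟫) - ∫ y, ⟪U t y, g y • bs i⟫
    rw [← integral_sub (hiv (hθi i) t ht.2) (hiU (hθi i) t ht)]
    refine integral_congr_ae (Eventually.of_forall fun y => ?_)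
    simp only [inner_sub_left]
  have he : ContinuousOn e (Ioo (-T) 0) :=
    continuousOn_finsetSum _ fun i _ => (hecomp i).smul continuousOn_const
  -- the representative on the window
  set V : ℝ → ℝ³ → ℝ³ := fun t x => U t x + e t with hV_def
  have hVtc : ∀ t ∈ Ioo (-T) 0, Continuous (V t) := fun t ht => (hUc t ht).add continuous_const
  have hVbd : ∀ t ∈ Ioo (-T) 0, ∀ x, ‖V t x‖ ≤ Cst 0 1 + ‖e t‖ := fun t ht x =>
    (norm_add_le _ _).trans (add_le_add (hUbd t ht x) le_rfl)
  have hiV : ∀ {θ : ℝ³ → ℝ³}, FunctionSpaces.IsTestFunctionOn (⊤ : Opens ℝ³) θ →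
      ∀ t ∈ Ioo (-T) 0, Integrable (fun x => ⟪V t x, θ x⟫) volume := fun hθ t ht =>
    integrable_inner_of_aestronglyMeasurable_of_norm_le (hVtc t ht).aestronglyMeasurable
      (hVbd t ht) (hθint hθ)
  -- (i) `V(t) = v(t)` a.e. for a.e. `t` in the window: there `e t = b t`
  have hae' : ∀ᵐ t ∂(volume.restrict (Ioo (-T) 0)), V t =ᵐ[volume] v t := by
    have h1 : ∀ᵐ t ∂(volume.restrict (Ioo (-T - 1) 0)), t ∈ Ioo (-T) 0 → V t =ᵐ[volume] v t := by
      filter_upwards [hae, ae_restrict_mem measurableSet_Ioo] with t ht htI htJ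
      have hvU : v t =ᵐ[volume] fun x => U t x + b t := (hwv t htI.2).symm.trans ht
      have hcomp : ∀ i, (∫ y, ⟪v t y - U t y, g y • bs i⟫) = ⟪bs i, b t⟫ := by
        intro i
        have h2 : (fun y => ⟪v t y - U t y, g y • bs i⟫) =ᵐ[volume] fun y => g y * ⟪bs i, b t⟫ := by
          filter_upwards [hvU] with y hy
          rw [hy, add_sub_cancel_left, real_inner_smul_right, real_inner_comm (bs i) (b t)]
        rw [integral_congr_ae h2, integral_mul_const, hg1, one_mul]
      have het : e t = b t := by
        simp only [he_def, hcomp]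
        exact bs.sum_repr' (b t)
      have hVt : V t = fun x => U t x + b t := by
        funext x
        simp only [hV_def, het]
      rw [hVt]
      exact hvU.symm
    rw [ae_restrict_iff' measurableSet_Ioo] at h1 ⊢
    filter_upwards [h1] with t ht htJ
    exact ht ⟨by linarith [htJ.1], htJ.2⟩ htJ
  -- (ii) joint continuity
  have hUj : ContinuousOn (uncurry U) (Ioo (-T) 0 ×ˢ univ) := by
    intro p hp
    have hp1 : p.1 ∈ Ioo (-T) 0 := (mem_prod.1 hp).1
    have hA : Tendsto (fun q : ℝ × ℝ³ => U q.1 q.2 - U p.1 q.2)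
        (𝓝[Ioo (-T) 0 ×ˢ univ] p) (𝓝 0) := by
      refine squeeze_zero_norm' (a := fun q : ℝ × ℝ³ => L 0 1 * |q.1 - p.1|) ?_ ?_
      · filter_upwards [self_mem_nhdsWithin] with q hq
        exact hU0 p.1 hp1 q.1 (mem_prod.1 hq).1 q.2
      · have h : Tendsto (fun q : ℝ × ℝ³ => L 0 1 * |q.1 - p.1|) (𝓝 p) (𝓝 (L 0 1 * |p.1 - p.1|)) :=
          (continuous_const.mul (continuous_fst.sub continuous_const).abs).tendsto p
        rw [sub_self, abs_zero, mul_zero] at h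
        exact h.mono_left nhdsWithin_le_nhds
    have hB : Tendsto (fun q : ℝ × ℝ³ => U p.1 q.2) (𝓝[Ioo (-T) 0 ×ˢ univ] p) (𝓝 (U p.1 p.2)) :=
      (((hUc p.1 hp1).tendsto p.2).comp (continuous_snd.tendsto p)).mono_left nhdsWithin_le_nhds
    have h := hA.add hB
    simp only [zero_add, sub_add_cancel] at h
    exact h
  have hVc : ContinuousOn (uncurry V) (Ioo (-T) 0 ×ˢ univ) := by
    have h : ContinuousOn (fun p : ℝ × ℝ³ => uncurry U p + e p.1) (Ioo (-T) 0 ×ˢ univ) :=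
      hUj.add (he.comp continuous_fst.continuousOn fun p hp => (mem_prod.1 hp).1)
    exact h.congr fun p _ => rfl
  -- (iii) the pairings of `V` are continuous in time
  have hpairV : ∀ θ : ℝ³ → ℝ³, FunctionSpaces.IsTestFunctionOn (⊤ : Opens ℝ³) θ →
      ContinuousOn (fun t => ∫ x, ⟪V t x, θ x⟫) (Ioo (-T) 0) := fun θ hθ => by
    have h1 := hpairU θ hθ
    have h2 : ContinuousOn (fun t => ⟪e t, ∫ x, θ x⟫) (Ioo (-T) 0) := he.inner continuousOn_const
    refine (h1.add h2).congr fun t ht => ?_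
    show ∫ x, ⟪U t x + e t, θ x⟫ = (∫ x, ⟪U t x, θ x⟫) + ⟪e t, ∫ x, θ x⟫
    rw [← integral_inner (hθint hθ) (e t), ← integral_add (hiU hθ t ht) ((hθint hθ).const_inner _)]
    refine integral_congr_ae (Eventually.of_forall fun x => ?_)
    simp only [inner_add_left]
  -- (iv) conclusion: for EVERY `t` in the window, `v(t) - V(t)` annihilates all test fields
  refine ⟨V, hVc, fun t ht => ?_⟩
  have hzero : ∀ θ : ℝ³ → ℝ³, FunctionSpaces.IsTestFunctionOn (⊤ : Opens ℝ³) θ →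
      ∫ x, ⟪v t x - V t x, θ x⟫ = 0 := by
    intro θ hθ
    have hP : ContinuousOn (fun τ => ∫ x, ⟪v τ x - V τ x, θ x⟫) (Ioo (-T) 0) := by
      refine (((hws θ hθ).mono Ioo_subset_Iio_self).sub (hpairV θ hθ)).congr fun τ hτ => ?_
      show ∫ x, ⟪v τ x - V τ x, θ x⟫ = (∫ x, ⟪v τ x, θ x⟫) - ∫ x, ⟪V τ x, θ x⟫
      rw [← integral_sub (hiv hθ τ hτ.2) (hiV hθ τ hτ)]
      refine integral_congr_ae (Eventually.of_forall fun x => ?_)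
      simp only [inner_sub_left]
    have hP0 : (fun τ => ∫ x, ⟪v τ x - V τ x, θ x⟫) =ᵐ[volume.restrict (Ioo (-T) 0)]
        fun _ => (0 : ℝ) := by
      filter_upwards [hae'] with τ hτ
      refine integral_eq_zero_of_ae ?_
      filter_upwards [hτ] with x hx
      simp [hx]
    exact Measure.eqOn_open_of_ae_eq hP0 isOpen_Ioo hP continuousOn_const ht
  have h0 : (fun x => v t x - V t x) =ᵐ[volume] 0 :=
    -- du Bois-Reymond for vector fields (tree: `FunctionSpaces.ae_eq_zero_of_forall_integral_inner_test_eq_zero`,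
    -- TestPairingLimits.lean), applied to the bounded measurable field `v t − V t`
    FunctionSpaces.ae_eq_zero_of_forall_integral_inner_test_eq_zero
      ((memLp_top_of_bound ((hmeas t ht.2).sub (hVtc t ht).aestronglyMeasurable)
          (M + (Cst 0 1 + ‖e t‖))
          (Eventually.of_forall fun x =>
            (norm_sub_le _ _).trans (add_le_add (hM t ht.2 x) (hVbd t ht x)))).locallyIntegrable
        le_top)
      hzero
  filter_upwards [h0] with x hx
  exact (sub_eq_zero.1 hx).symm

end Bounded

end Summit.NavierStokesRegularity.NavierStokesRegularity.Theorems.RootDecompFactorLadderRepresentativeWindow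

end
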